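import Mathlib
import Summits.ValiantsHypothesis.ValiantsHypothesis.Theses.ProjectionRigidity
import Literature.Computability.AlgebraicComplexity.GrenetProjection
import Literature.Computability.AlgebraicComplexity.DetReprEquivalent
import Literature.Computability.AlgebraicComplexity.StandardFamiliesProofs
import Literature.Computability.AlgebraicComplexity.RankOneDeterminantalExpressionsProofs
import Summits.ValiantsHypothesis.ValiantsHypothesis.Theorems.PdcQpOfVp.Negative.AffineToProjectionBlowup

/-!
# Crux `ProjLaplaceDoubling` (stmt-ValiantsHypothesis-16002): the level below the guard `n ≥ 3`

Load-bearing analysis of the crux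
`ProjOptimalUnique → ∀ n ≥ 3, 2ⁿ − 1 ≤ pdc(per_n) → 2ⁿ⁺¹ − 1 ≤ pdc(per_{n+1})` at the first sizes,
where everything is decidable by hand (refuter cdisprove seat, cycle 1, 2026-08-17):

* (tree, `Theorems/PdcQpOfVp/Negative/AffineToProjectionBlowup.lean`, reused:) `pdc(per₀,₁,₂) = 0, 1, 3`
  and `dc(per₂) ≤ 2` — the doubling numerology `pdc(per_{n+1}) = 2·pdc(per_n) + 1` holds below the
  guard (`1 → 3 → 7`, with `pdc(per₃) = 7` in the tree), whereas in the AFFINE model it fails at once: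
* `affineDoubling_false_from_one` — `¬ (∀ n ≥ 1, 2ⁿ − 1 ≤ dc(per_n) → 2ⁿ⁺¹ − 1 ≤ dc(per_{n+1}))`
  (`dc(per₁) ≥ 1`, `dc(per₂) ≤ 2 < 3`): the projection model (no signed variable cells) is what lets a
  doubling start at all.
* `projOptimalUnique_false_at_two` — the `n = 2`, `m = 3 = pdc(per₂)` analogue of the crux's
  hypothesis (`ProjOptimalUnique`, guard `n ≥ 3`; support item `ProjOptimalUniqueThree` is its `n = 3`
  instance) is FALSE: Grenet₂ `[[0, X00, X10],[X11, −1, 0],[X01, 0, −1]]` (constant part of rank 2)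
  and the Schur lift `[[X00, 0, X10],[X01, X11, 0],[0, 1, 1]]` of the signed `2 × 2` determinant
  (constant part of rank 1, a single non-zero row) are both optimal projections of `per₂`; constant
  gauge `P · – · Q` maps a one-row constant part to an outer product, whose `2 × 2` minors vanish,
  while `diag(0, −1, −1)` has the minor `1`; linear substitutions `γ` and transposition do not touch /
  transpose the constant part.  So the guard `n ≥ 3` of the hypothesis is load-bearing, and the
  doubling `3 → 7` holds WITHOUT uniqueness at the lower level: uniqueness is this route's engine,
  not a necessity of the numbers.  (The same purification-by-one-extra-vertex phenomenon, one size
  up, is what makes `8 × 8` projections of `per₃` escape window normal forms: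
  `Negative/StubWindowReductionFalse.lean`.)

All statements are negations / numerical facts; none asserts a Theses decl.  Unconditional.
-/

-- single-conjunct layout: Sub = Summit, duplicated namespace component intended
set_option linter.dupNamespace false

namespace Summit.ValiantsHypothesis.ValiantsHypothesis.Theorems.ProjLaplaceDoubling.Negative

open MvPolynomial Matrix
open Literature.Computability.AlgebraicComplexity
open Summit.ValiantsHypothesis.ValiantsHypothesis.Theses.ProjectionRigidity

/-- `per₂ = X00·X11 + X10·X01` in the tree's convention `per = ∑_σ ∏_c X(σ c, c)`. -/
private theorem perPoly_two_eq :
    perPoly (Fin 2) ℂ = X (0,0) * X (1,1) + X (1,0) * X (0,1) := by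
  simp [perPoly, permanent_fin_two, Matrix.mvPolynomialX_apply]

/-- **The affine analogue of the doubling pattern fails at its root**: `dc(per₁) ≥ 1 = 2¹ − 1` but
`dc(per₂) ≤ 2 < 2² − 1` (tree: `PdcQpOfVp.Negative.determinantalComplexity_perPoly_two_le`).  In the
projection model `pdc(per₂) = 3 = 2·1 + 1` (tree: `PdcQpOfVp.Negative.detProjectionComplexity_perPoly_two`).
[folklore] -/
theorem affineDoubling_false_from_one : ¬ (∀ n ≥ 1,
    2 ^ n - 1 ≤ determinantalComplexity (perPoly (Fin n) ℂ) →
      2 ^ (n + 1) - 1 ≤ determinantalComplexity (perPoly (Fin (n + 1)) ℂ)) := by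
  intro h
  have h1 : 2 ^ 1 - 1 ≤ determinantalComplexity (perPoly (Fin 1) ℂ) := by
    have hne : Set.Nonempty {m | HasDetRepr (perPoly (Fin 1) ℂ) m} :=
      ⟨1, show HasDetRepr (perPoly (Fin 1) ℂ) 1 from ⟨!![X (0,0)],
        fun i j => by fin_cases i; fin_cases j; simp [totalDegree_X],
        by simp [perPoly, Matrix.permanent, Matrix.mvPolynomialX_apply]⟩⟩
    apply le_csInf hne
    intro m hm
    rw [Set.mem_setOf_eq] at hm
    obtain ⟨A, -, hA⟩ := hm
    by_contra hm
    rw [not_le] at hm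
    obtain _ | m := m
    · rw [Matrix.det_isEmpty] at hA
      have := congrArg constantCoeff hA
      simp [perPoly, Matrix.permanent, Matrix.mvPolynomialX_apply] at this
    · omega
  have h2 : 2 ^ 2 - 1 ≤ determinantalComplexity (perPoly (Fin 2) ℂ) := h 1 le_rfl h1
  have h3 := Summit.ValiantsHypothesis.Theorems.PdcQpOfVp.Negative.determinantalComplexity_perPoly_two_le
  omega

set_option maxHeartbeats 800000 in
/-- **The `n = 2` analogue of `ProjOptimalUnique` is false**: at the optimal size `3 = pdc(per₂)`
(tree: `PdcQpOfVp.Negative.detProjectionComplexity_perPoly_two`) the projections Grenet₂ and the Schur lift of the signed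
`2 × 2` determinant are not related by `GL₃(ℂ)² × permSymmetrySubst × ᵀ` — the constant part of the
former is `diag(0, −1, −1)`, of the latter the single row `(0, 1, 1)`; constant gauge maps the latter
to an outer product (all `2 × 2` minors zero), linear substitutions fix constant parts, transposition
transposes them.  So the guard `n ≥ 3` of the crux's hypothesis is load-bearing, and the doubling
`pdc: 3 → 7` holds without uniqueness at the lower level. [folklore] -/
theorem projOptimalUnique_false_at_two : ¬ (∀ A B : Matrix (Fin 3) (Fin 3) (MvPolynomial (Fin 2 × Fin 2) ℂ),
    (∀ i j, (∃ v, A i j = MvPolynomial.X v) ∨ ∃ c, A i j = MvPolynomial.C c) →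
    (∀ i j, (∃ v, B i j = MvPolynomial.X v) ∨ ∃ c, B i j = MvPolynomial.C c) →
    A.det = perPoly (Fin 2) ℂ → B.det = perPoly (Fin 2) ℂ →
    ∃ (P Q : GL (Fin 3) ℂ) (γ : GL (Fin 2 × Fin 2) ℂ), γ ∈ permSymmetrySubst ℂ 2 ∧
      (B = (P : Matrix (Fin 3) (Fin 3) ℂ).map MvPolynomial.C *
            Literature.Computability.AlgebraicComplexity.Matrix.linSubstEntries γ A *
            (Q : Matrix (Fin 3) (Fin 3) ℂ).map MvPolynomial.C ∨
       B = (P : Matrix (Fin 3) (Fin 3) ℂ).map MvPolynomial.C *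
            (Literature.Computability.AlgebraicComplexity.Matrix.linSubstEntries γ A).transpose *
            (Q : Matrix (Fin 3) (Fin 3) ℂ).map MvPolynomial.C)) := by
  intro h
  obtain ⟨S, hS⟩ : ∃ M : Matrix (Fin 3) (Fin 3) (MvPolynomial (Fin 2 × Fin 2) ℂ), M =
      !![X (0,0), 0, X (1,0); X (0,1), X (1,1), 0; 0, 1, 1] := ⟨_, rfl⟩
  obtain ⟨G, hG⟩ : ∃ M : Matrix (Fin 3) (Fin 3) (MvPolynomial (Fin 2 × Fin 2) ℂ), M =
      !![0, X (0,0), X (1,0); X (1,1), -1, 0; X (0,1), 0, -1] := ⟨_, rfl⟩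
  have cells : ∀ i j : Fin 3, (S i j = 0 ∨ S i j = 1 ∨ ∃ w, S i j = X w) ∧
      (G i j = 0 ∨ G i j = -1 ∨ ∃ w, G i j = X w) := by
    intro i j
    rw [hS, hG]
    fin_cases i <;> fin_cases j <;> simp
  have hSproj : ∀ i j, (∃ v, S i j = MvPolynomial.X v) ∨ ∃ c, S i j = MvPolynomial.C c := by
    intro i j
    rcases (cells i j).1 with h0 | h1 | ⟨w, hw⟩
    · exact Or.inr ⟨0, by rw [h0, map_zero]⟩
    · exact Or.inr ⟨1, by rw [h1, map_one]⟩
    · exact Or.inl ⟨w, hw⟩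
  have hGproj : ∀ i j, (∃ v, G i j = MvPolynomial.X v) ∨ ∃ c, G i j = MvPolynomial.C c := by
    intro i j
    rcases (cells i j).2 with h0 | h1 | ⟨w, hw⟩
    · exact Or.inr ⟨0, by rw [h0, map_zero]⟩
    · exact Or.inr ⟨-1, by rw [h1, map_neg, map_one]⟩
    · exact Or.inl ⟨w, hw⟩
  have hSdet : S.det = perPoly (Fin 2) ℂ := by
    rw [hS, Matrix.det_fin_three, perPoly_two_eq]
    simp
  have hGdet : G.det = perPoly (Fin 2) ℂ := by
    rw [hG, Matrix.det_fin_three, perPoly_two_eq]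
    simp
  obtain ⟨P, Q, γ, -, hPQ⟩ := h S G hSproj hGproj hSdet hGdet
  -- ### constant parts: `cc ∘ linSubst = cc`, `cc ∘ C = id`
  have ccL : ∀ (Γ : Matrix (Fin 2 × Fin 2) (Fin 2 × Fin 2) ℂ) (f : MvPolynomial (Fin 2 × Fin 2) ℂ),
      constantCoeff (linSubst (Fin 2 × Fin 2) ℂ Γ f) = constantCoeff f := by
    intro Γ f
    have key : (constantCoeff.comp (linSubst (Fin 2 × Fin 2) ℂ Γ : MvPolynomial (Fin 2 × Fin 2) ℂ →+*
        MvPolynomial (Fin 2 × Fin 2) ℂ)) = (constantCoeff : MvPolynomial (Fin 2 × Fin 2) ℂ →+* ℂ) := by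
      apply ringHom_ext
      · intro c
        simp
      · intro i
        simp [linSubst_X]
    exact RingHom.congr_fun key f
  have mapS : (Literature.Computability.AlgebraicComplexity.Matrix.linSubstEntries γ S).map constantCoeff =
      !![(0 : ℂ), 0, 0; 0, 0, 0; 0, 1, 1] := by
    ext i j
    simp only [Literature.Computability.AlgebraicComplexity.Matrix.linSubstEntries, Matrix.map_apply, ccL]
    rw [hS]
    fin_cases i <;> fin_cases j <;> simp
  have mapG : G.map constantCoeff = !![(0 : ℂ), 0, 0; 0, -1, 0; 0, 0, -1] := by
    ext i j
    rw [hG]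
    fin_cases i <;> fin_cases j <;> simp
  have mapP : ∀ R : Matrix (Fin 3) (Fin 3) ℂ,
      ((R.map C : Matrix (Fin 3) (Fin 3) (MvPolynomial (Fin 2 × Fin 2) ℂ))).map constantCoeff = R := by
    intro R
    ext i j
    simp [constantCoeff_C]
  rcases hPQ with hB | hB
  · have h0 := congrArg (fun M : Matrix (Fin 3) (Fin 3) (MvPolynomial (Fin 2 × Fin 2) ℂ) =>
        M.map (constantCoeff : MvPolynomial (Fin 2 × Fin 2) ℂ →+* ℂ)) hB
    simp only [Matrix.map_mul, mapG, mapS, mapP] at h0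
    -- entries (1,1), (2,1), (2,2) of `diag(0,-1,-1) = P · (e₂ ⊗ (0,1,1)) · Q`
    have e11 : (-1 : ℂ) = (P : Matrix (Fin 3) (Fin 3) ℂ) 1 2 * (Q : Matrix (Fin 3) (Fin 3) ℂ) 1 1 +
        (P : Matrix (Fin 3) (Fin 3) ℂ) 1 2 * (Q : Matrix (Fin 3) (Fin 3) ℂ) 2 1 := by
      simpa [Matrix.mul_apply, Fin.sum_univ_three, mul_add] using congrFun (congrFun h0 1) 1
    have e21 : (0 : ℂ) = (P : Matrix (Fin 3) (Fin 3) ℂ) 2 2 * (Q : Matrix (Fin 3) (Fin 3) ℂ) 1 1 +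
        (P : Matrix (Fin 3) (Fin 3) ℂ) 2 2 * (Q : Matrix (Fin 3) (Fin 3) ℂ) 2 1 := by
      simpa [Matrix.mul_apply, Fin.sum_univ_three, mul_add] using congrFun (congrFun h0 2) 1
    have e22 : (-1 : ℂ) = (P : Matrix (Fin 3) (Fin 3) ℂ) 2 2 * (Q : Matrix (Fin 3) (Fin 3) ℂ) 1 2 +
        (P : Matrix (Fin 3) (Fin 3) ℂ) 2 2 * (Q : Matrix (Fin 3) (Fin 3) ℂ) 2 2 := by
      simpa [Matrix.mul_apply, Fin.sum_univ_three, mul_add] using congrFun (congrFun h0 2) 2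
    rcases mul_eq_zero.mp (show (P : Matrix (Fin 3) (Fin 3) ℂ) 2 2 *
        ((Q : Matrix (Fin 3) (Fin 3) ℂ) 1 1 + (Q : Matrix (Fin 3) (Fin 3) ℂ) 2 1) = 0 by
          linear_combination -e21) with hp | hq
    · have : (-1 : ℂ) = 0 := by
        linear_combination e22 + ((Q : Matrix (Fin 3) (Fin 3) ℂ) 1 2 + (Q : Matrix (Fin 3) (Fin 3) ℂ) 2 2) * hp
      norm_num at this
    · have : (-1 : ℂ) = 0 := by linear_combination e11 + (P : Matrix (Fin 3) (Fin 3) ℂ) 1 2 * hq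
      norm_num at this
  · have h0 := congrArg (fun M : Matrix (Fin 3) (Fin 3) (MvPolynomial (Fin 2 × Fin 2) ℂ) =>
        M.map (constantCoeff : MvPolynomial (Fin 2 × Fin 2) ℂ →+* ℂ)) hB
    simp only [Matrix.map_mul, Matrix.transpose_map, mapG, mapS, mapP] at h0
    -- entries (1,1), (2,1), (2,2) of `diag(0,-1,-1) = P · ((0,1,1)ᵀ ⊗ e₂) · Q`
    have e11 : (-1 : ℂ) = (P : Matrix (Fin 3) (Fin 3) ℂ) 1 1 * (Q : Matrix (Fin 3) (Fin 3) ℂ) 2 1 +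
        (P : Matrix (Fin 3) (Fin 3) ℂ) 1 2 * (Q : Matrix (Fin 3) (Fin 3) ℂ) 2 1 := by
      simpa [Matrix.mul_apply, Fin.sum_univ_three, mul_add, add_mul] using congrFun (congrFun h0 1) 1
    have e21 : (0 : ℂ) = (P : Matrix (Fin 3) (Fin 3) ℂ) 2 1 * (Q : Matrix (Fin 3) (Fin 3) ℂ) 2 1 +
        (P : Matrix (Fin 3) (Fin 3) ℂ) 2 2 * (Q : Matrix (Fin 3) (Fin 3) ℂ) 2 1 := by
      simpa [Matrix.mul_apply, Fin.sum_univ_three, mul_add, add_mul] using congrFun (congrFun h0 2) 1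
    have e22 : (-1 : ℂ) = (P : Matrix (Fin 3) (Fin 3) ℂ) 2 1 * (Q : Matrix (Fin 3) (Fin 3) ℂ) 2 2 +
        (P : Matrix (Fin 3) (Fin 3) ℂ) 2 2 * (Q : Matrix (Fin 3) (Fin 3) ℂ) 2 2 := by
      simpa [Matrix.mul_apply, Fin.sum_univ_three, mul_add, add_mul] using congrFun (congrFun h0 2) 2
    rcases mul_eq_zero.mp (show ((P : Matrix (Fin 3) (Fin 3) ℂ) 2 1 + (P : Matrix (Fin 3) (Fin 3) ℂ) 2 2) *
        (Q : Matrix (Fin 3) (Fin 3) ℂ) 2 1 = 0 by linear_combination -e21) with hp | hq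
    · have : (-1 : ℂ) = 0 := by linear_combination e22 + (Q : Matrix (Fin 3) (Fin 3) ℂ) 2 2 * hp
      norm_num at this
    · have : (-1 : ℂ) = 0 := by
        linear_combination e11 + ((P : Matrix (Fin 3) (Fin 3) ℂ) 1 1 + (P : Matrix (Fin 3) (Fin 3) ℂ) 1 2) * hq
      norm_num at this

end Summit.ValiantsHypothesis.ValiantsHypothesis.Theorems.ProjLaplaceDoubling.Negative
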